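import Mathlib
import Summits.PneNP.PneNP.Theses.KarlinRubin
import Summits.PneNP.PneNP.Theorems.KarlinRubinMonotoneSufficesTransportBridge
import Summits.PneNP.PneNP.Theorems.KarlinRubinMonotoneSufficesTransportBinomial
import Summits.PneNP.PneNP.Theorems.KarlinRubinMonotoneSufficesTransportSlices
import Literature.Computability.Complexity.BinomialTV

/-!
# Crux `MonotoneSuffices` (stmt-PneNP-18026), line `Sketch` — density-shift rung (W6), stub
# `stub_thresholdSharp`: edge-count thresholds are `√N`-sharp

The density-shift rung of line `Sketch` replaces the input `x` of a detector (an edge-indicator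
vector of `Kₙ`, null law `G(n,1/2)` = uniform) by the up-shift `x ∨ 1_R` for a random `r`-set `R` of
edge slots, which forces every `√N`-sharp monotone gate to `1` (`N = C(n,2)` slots). This file proves
that the EDGE-COUNT THRESHOLD gates `[θ ≤ #supp x]` qualify, uniformly in `θ`: for every `ε > 0` there
is `C` such that for all large `n` and EVERY `θ`, either every `(C n)`-up-shift forces the threshold
except with null probability `≤ ε`, or the threshold is null-rare (`Pr_{G(n,1/2)}[θ ≤ #supp x] ≤ ε`).
Chebyshev only (`C = 4 C'` with `ε C' ≥ 1`):

* `thresholdSharp_card_filter_le_supp_le` — `#{x | θ ≤ #supp x} ≤ ∑_{θ ≤ j ≤ N} C(N, j)` on a cube;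
* `thresholdSharp_card_filter_ins_lt_le` — `#{x | #supp (x ∨ 1_R) < θ} ≤ 2^{#R} ∑_{i < θ - #R} C(N - #R, i)`
  (the up-shift is `2^{#R}`-to-one onto the vectors containing `R`: `SliceTransport.sum_plant_eq`,
  `SliceTransport.card_slice_supset`);
* `thresholdSharp_erdosRenyiHalf_le_ofReal` — counting to probability under `G(n,1/2)`;
* `stub_thresholdSharp` — if `θ ≤ N/2 + C' n` the first count is a lower Chebyshev tail of
  `Bin(N - 4 C' n, 1/2)` at deviation `C' n` (`SliceTransport.sum_b_le_of_add_le`), otherwise the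
  second is an upper tail of `Bin(N, 1/2)` at deviation `C' n` (`SliceTransport.sum_b_le_of_half_add_le`);
  both are `≤ N/(C' n)² ≤ 1/C'² ≤ ε`.
-/

set_option linter.dupNamespace false -- `Summit.PneNP.PneNP.…`: summit = sub-problem name (D-0017)

namespace Summit.PneNP.PneNP.Theorems.MonotoneSuffices.DensityShift

open Literature.Computability.Complexity Literature.Probability.RandomGraphs.PlantedClique Filter Finset
open Literature.Computability.Complexity.BinomialTV
open Summit.PneNP.PneNP.Theorems.MonotoneSuffices.SliceTransport
open scoped ENNReal

/-! ### Counting on the cube `α → Bool` -/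

section Counting

variable {α : Type*} [Fintype α] [DecidableEq α]

/-- **Upper tail count**: `#{x | θ ≤ #supp x} ≤ ∑_{θ ≤ j ≤ N} C(N, j)` on the cube `α → Bool`
(`N = |α|`; fibre over the weight `#supp x`, each slice counted by `card_slice_eq_choose`). [folklore] -/
theorem thresholdSharp_card_filter_le_supp_le (θ : ℕ) :
    #((univ : Finset (α → Bool)).filter fun x => θ ≤ #(univ.filter fun a => x a = true)) ≤
      ∑ j ∈ (range (Fintype.card α + 1)).filter (fun j => θ ≤ j), (Fintype.card α).choose j := by
  calc #((univ : Finset (α → Bool)).filter fun x => θ ≤ #(univ.filter fun a => x a = true))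
      ≤ #(((range (Fintype.card α + 1)).filter (fun j => θ ≤ j)).biUnion fun j =>
          (univ : Finset (α → Bool)).filter fun y => #(univ.filter fun a => y a = true) = j) := by
        refine card_le_card fun x hx => ?_
        rw [mem_filter] at hx
        exact mem_biUnion.2 ⟨#(univ.filter fun a => x a = true),
          mem_filter.2 ⟨mem_range.2 (Nat.lt_succ_of_le (card_le_univ _)), hx.2⟩,
          mem_filter.2 ⟨mem_univ _, rfl⟩⟩
    _ ≤ ∑ j ∈ (range (Fintype.card α + 1)).filter (fun j => θ ≤ j),
          #((univ : Finset (α → Bool)).filter fun y => #(univ.filter fun a => y a = true) = j) :=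
        card_biUnion_le
    _ = ∑ j ∈ (range (Fintype.card α + 1)).filter (fun j => θ ≤ j), (Fintype.card α).choose j :=
        sum_congr rfl fun j _ => card_slice_eq_choose j

/-- **Protected lower slices**: the vectors `y ⊇ R` (i.e. `R ⊆ supp y`) of weight `< θ` number at most
`∑_{i < θ - #R} C(N - #R, i)` (fibre over `i = #supp y - #R`, `card_slice_supset`). [folklore] -/
theorem thresholdSharp_card_filter_supset_lt_le (R : Finset α) (θ : ℕ) :
    #((univ : Finset (α → Bool)).filter fun y =>
        R ⊆ (univ.filter fun a => y a = true) ∧ #(univ.filter fun a => y a = true) < θ) ≤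
      ∑ i ∈ range (θ - #R), (Fintype.card α - #R).choose i := by
  calc #((univ : Finset (α → Bool)).filter fun y =>
        R ⊆ (univ.filter fun a => y a = true) ∧ #(univ.filter fun a => y a = true) < θ)
      ≤ #((range (θ - #R)).biUnion fun i => (univ : Finset (α → Bool)).filter fun y =>
          #(univ.filter fun a => y a = true) = #R + i ∧ R ⊆ univ.filter fun a => y a = true) := by
        refine card_le_card fun y hy => ?_
        rw [mem_filter] at hy
        obtain ⟨-, hRy, hyθ⟩ := hy
        have hle : #R ≤ #(univ.filter fun a => y a = true) := card_le_card hRy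
        exact mem_biUnion.2 ⟨#(univ.filter fun a => y a = true) - #R, mem_range.2 (by omega),
          mem_filter.2 ⟨mem_univ _, by omega, hRy⟩⟩
    _ ≤ ∑ i ∈ range (θ - #R), #((univ : Finset (α → Bool)).filter fun y =>
          #(univ.filter fun a => y a = true) = #R + i ∧ R ⊆ univ.filter fun a => y a = true) :=
        card_biUnion_le
    _ = ∑ i ∈ range (θ - #R), (Fintype.card α - #R).choose i :=
        sum_congr rfl fun i _ => by rw [card_slice_supset R (Nat.le_add_right _ _), Nat.add_sub_cancel_left]

/-- **Lower tail count after an up-shift**: `#{x | #supp (x ∨ 1_R) < θ} ≤ 2^{#R} ∑_{i < θ - #R} C(N - #R, i)`: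
the up-shift `x ↦ x ∨ 1_R` is `2^{#R}`-to-one onto the vectors containing `R` (`sum_plant_eq`).
[folklore] -/
theorem thresholdSharp_card_filter_ins_lt_le (R : Finset α) (θ : ℕ) :
    (#((univ : Finset (α → Bool)).filter fun x =>
        #(univ.filter fun a => (x a || decide (a ∈ R)) = true) < θ) : ℝ) ≤
      2 ^ #R * ∑ i ∈ range (θ - #R), ((Fintype.card α - #R).choose i : ℝ) := by
  have h := sum_plant_eq R (fun y => if #(univ.filter fun a => y a = true) < θ then (1 : ℝ) else 0)
  simp only [sum_boole, filter_filter] at h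
  refine h.le.trans ?_
  exact mul_le_mul_of_nonneg_left (by exact_mod_cast thresholdSharp_card_filter_supset_lt_le R θ)
    (by positivity)

end Counting

/-! ### Binomial weights and the null law -/

/-- `∑_{i ∈ s} C(M, i) = 2^M · ∑_{i ∈ s} b M i` (`b M i = C(M, i)/2^M`). [folklore] -/
theorem thresholdSharp_sum_choose_eq (M : ℕ) (s : Finset ℕ) :
    ∑ i ∈ s, (M.choose i : ℝ) = 2 ^ M * ∑ i ∈ s, b M i := by
  rw [mul_sum]
  refine sum_congr rfl fun i _ => ?_
  rw [b]
  field_simp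

/-- **Counting to probability**: a bound `#S ≤ 2^{C(n,2)} · e` reads `Pr_{G(n,1/2)}[S] ≤ e`
(`G(n,1/2)` is uniform on the `2^{C(n,2)}` edge vectors). [folklore] -/
theorem thresholdSharp_erdosRenyiHalf_le_ofReal {n : ℕ} (S : Set (EdgeVec n)) [DecidablePred (· ∈ S)]
    {e : ℝ} (he : 0 ≤ e)
    (h : (#((univ : Finset (EdgeVec n)).filter fun x => x ∈ S) : ℝ) ≤ 2 ^ n.choose 2 * e) :
    (erdosRenyiHalf n).toOuterMeasure S ≤ ENNReal.ofReal e := by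
  classical
  have hS : (erdosRenyiHalf n).toOuterMeasure S =
      (#((univ : Finset (EdgeVec n)).filter fun x => x ∈ S) : ℝ≥0∞) / (Fintype.card (EdgeVec n) : ℝ≥0∞) := by
    rw [erdosRenyiHalf, PMF.uniformOfFintype, PMF.toOuterMeasure_uniformOfFinset_apply, card_univ]
    congr
  have hM : Fintype.card (EdgeVec n) = 2 ^ n.choose 2 := by
    convert Literature.Probability.RandomGraphs.card_edgeVec n
  have hM0 : (Fintype.card (EdgeVec n) : ℝ≥0∞) ≠ 0 := Nat.cast_ne_zero.2 Fintype.card_ne_zero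
  have hMtop : (Fintype.card (EdgeVec n) : ℝ≥0∞) ≠ ⊤ := ENNReal.natCast_ne_top _
  rw [hS, ENNReal.div_le_iff hM0 hMtop]
  have hR : (#((univ : Finset (EdgeVec n)).filter fun x => x ∈ S) : ℝ) ≤ e * (Fintype.card (EdgeVec n) : ℝ) := by
    rw [hM]
    push_cast
    linarith
  calc (#((univ : Finset (EdgeVec n)).filter fun x => x ∈ S) : ℝ≥0∞)
      = ENNReal.ofReal (#((univ : Finset (EdgeVec n)).filter fun x => x ∈ S) : ℝ) := by
        rw [ENNReal.ofReal_natCast]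
    _ ≤ ENNReal.ofReal (e * (Fintype.card (EdgeVec n) : ℝ)) := ENNReal.ofReal_le_ofReal hR
    _ = ENNReal.ofReal e * (Fintype.card (EdgeVec n) : ℝ≥0∞) := by
        rw [ENNReal.ofReal_mul he, ENNReal.ofReal_natCast]

/-! ### The stub -/

/-- **`stub_thresholdSharp`** (registered stub of stmt-PneNP-18026, line `Sketch`, density-shift rung
W6): **edge-count thresholds are `√N`-sharp, uniformly in the threshold.** For every `ε > 0` there is
`C` such that eventually in `n`, for EVERY `θ`, either every up-shift `x ∨ 1_R` by a `(C n)`-set `R` of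
edge slots reaches weight `≥ θ` except with `G(n,1/2)`-probability `≤ ε`, or
`Pr_{G(n,1/2)}[θ ≤ #supp x] ≤ ε` (Chebyshev at deviation `C' n ≍ √N`, `C = 4 C'`, `ε C' ≥ 1`). [folklore] -/
theorem stub_thresholdSharp :
    ∀ ε : ℝ, 0 < ε → ∃ C : ℕ, ∀ᶠ n : ℕ in atTop, ∀ θ : ℕ,
      (∀ R ∈ (univ : Finset ((⊤ : SimpleGraph (Fin n)).edgeSet)).powersetCard (C * n),
          (erdosRenyiHalf n).toOuterMeasure
              {x | #(univ.filter fun e => (x e || decide (e ∈ R)) = true) < θ} ≤ ENNReal.ofReal ε) ∨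
        (erdosRenyiHalf n).toOuterMeasure {x | θ ≤ #(univ.filter fun e => x e = true)} ≤ ENNReal.ofReal ε := by
  classical
  intro ε hε
  -- the constant `C = 4 C'` with `1 ≤ ε C'`: all Chebyshev bounds below are `≤ N/(C' n)² ≤ 1/C'² ≤ ε`
  obtain ⟨C', hC'1, hC'ε⟩ : ∃ C' : ℕ, 1 ≤ C' ∧ 1 ≤ ε * C' := by
    refine ⟨⌈1 / ε⌉₊ + 1, by omega, ?_⟩
    push_cast
    calc (1 : ℝ) ≤ 1 + ε := by linarith
      _ = ε * (1 / ε + 1) := by rw [mul_add, mul_one_div_cancel hε.ne', mul_one]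
      _ ≤ ε * ((⌈1 / ε⌉₊ : ℝ) + 1) := by
          gcongr
          exact Nat.le_ceil _
  refine ⟨4 * C', ?_⟩
  filter_upwards [eventually_ge_atTop 1] with n hn θ
  -- notation: `N = C(n,2)` slots, deviation scale `t = C' n`
  obtain ⟨N, hN⟩ : ∃ N : ℕ, n.choose 2 = N := ⟨_, rfl⟩
  obtain ⟨t, ht⟩ : ∃ t : ℕ, C' * n = t := ⟨_, rfl⟩
  have hE : Fintype.card ((⊤ : SimpleGraph (Fin n)).edgeSet) = N := by
    rw [← hN]
    convert card_edgeSet_top_fin n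
  have ht0 : 0 < t := by
    rw [← ht]
    exact Nat.mul_pos hC'1 hn
  have ht0' : (0 : ℝ) < t := by exact_mod_cast ht0
  -- the basic estimate `N ≤ n² ≤ ε (C' n)²`
  have hkey : (N : ℝ) ≤ ε * (t : ℝ) ^ 2 := by
    have hNn : (N : ℝ) ≤ (n : ℝ) ^ 2 := by
      rw [← hN]
      exact_mod_cast Nat.choose_le_pow n 2
    have ht' : (t : ℝ) = C' * n := by
      rw [← ht]
      push_cast
      ring
    have hC'1' : (1 : ℝ) ≤ C' := by exact_mod_cast hC'1
    have h1 : (1 : ℝ) * 1 ≤ ε * C' * C' := mul_le_mul hC'ε hC'1' zero_le_one (zero_le_one.trans hC'ε)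
    rw [ht']
    calc (N : ℝ) ≤ (1 * 1) * (n : ℝ) ^ 2 := by rw [one_mul, one_mul]; exact hNn
      _ ≤ (ε * C' * C') * (n : ℝ) ^ 2 := mul_le_mul_of_nonneg_right h1 (sq_nonneg _)
      _ = ε * ((C' : ℝ) * n) ^ 2 := by ring
  by_cases hθ : θ ≤ N / 2 + t
  · -- CASE A (`θ ≤ N/2 + C' n`): every `4 C' n`-up-shift forces the threshold
    refine Or.inl fun R hR => ?_
    have hRcard : #R = 4 * t := by
      rw [(mem_powersetCard.1 hR).2, ← ht]
      ring
    have hrN : 4 * t ≤ N := by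
      have := card_le_univ R
      rwa [hRcard, hE] at this
    refine thresholdSharp_erdosRenyiHalf_le_ofReal _ hε.le ?_
    rw [hN]
    -- the index inclusion behind the Chebyshev tail of `Bin(N - 4t, 1/2)` at deviation `t`
    have hsub : range (θ - 4 * t) ⊆ (range (N - 4 * t + 1)).filter (fun j => 2 * (j + t) ≤ N - 4 * t) := by
      intro j hj
      rw [mem_range] at hj
      rw [mem_filter, mem_range]
      omega
    have htail : ∑ i ∈ range (θ - 4 * t), b (N - 4 * t) i ≤ ((N - 4 * t : ℕ) : ℝ) / 4 / (t : ℝ) ^ 2 :=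
      (sum_le_sum_of_subset_of_nonneg hsub fun i _ _ => b_nonneg _ _).trans
        (sum_b_le_of_add_le (N - 4 * t) ht0)
    have hfin : ((N - 4 * t : ℕ) : ℝ) / 4 / (t : ℝ) ^ 2 ≤ ε := by
      rw [div_div, div_le_iff₀ (mul_pos four_pos (pow_pos ht0' 2))]
      have h1 : ((N - 4 * t : ℕ) : ℝ) ≤ N := by exact_mod_cast Nat.sub_le N (4 * t)
      have h2 : (0 : ℝ) ≤ ε * (t : ℝ) ^ 2 := mul_nonneg hε.le (sq_nonneg _)
      linarith
    calc (#((univ : Finset (EdgeVec n)).filter fun x =>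
          #(univ.filter fun e => (x e || decide (e ∈ R)) = true) < θ) : ℝ)
        ≤ 2 ^ #R * ∑ i ∈ range (θ - #R),
            ((Fintype.card ((⊤ : SimpleGraph (Fin n)).edgeSet) - #R).choose i : ℝ) :=
          thresholdSharp_card_filter_ins_lt_le R θ
      _ = 2 ^ (4 * t) * (2 ^ (N - 4 * t) * ∑ i ∈ range (θ - 4 * t), b (N - 4 * t) i) := by
          rw [hRcard, hE, thresholdSharp_sum_choose_eq]
      _ ≤ 2 ^ (4 * t) * (2 ^ (N - 4 * t) * (((N - 4 * t : ℕ) : ℝ) / 4 / (t : ℝ) ^ 2)) :=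
          mul_le_mul_of_nonneg_left (mul_le_mul_of_nonneg_left htail (by positivity)) (by positivity)
      _ = 2 ^ N * (((N - 4 * t : ℕ) : ℝ) / 4 / (t : ℝ) ^ 2) := by
          rw [← mul_assoc, ← pow_add, Nat.add_sub_cancel' hrN]
      _ ≤ 2 ^ N * ε := mul_le_mul_of_nonneg_left hfin (by positivity)
  · -- CASE B (`N/2 + C' n < θ`): the threshold is null-rare
    refine Or.inr (thresholdSharp_erdosRenyiHalf_le_ofReal _ hε.le ?_)
    rw [hN]
    have hsub : (range (N + 1)).filter (fun j => θ ≤ j) ⊆ (range (N + 1)).filter (fun j => N / 2 + t ≤ j) := by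
      intro j hj
      rw [mem_filter] at hj ⊢
      exact ⟨hj.1, by omega⟩
    calc (#((univ : Finset (EdgeVec n)).filter fun x => θ ≤ #(univ.filter fun e => x e = true)) : ℝ)
        ≤ ∑ j ∈ (range (N + 1)).filter (fun j => θ ≤ j), (N.choose j : ℝ) := by
          have h := thresholdSharp_card_filter_le_supp_le (α := (⊤ : SimpleGraph (Fin n)).edgeSet) θ
          rw [hE] at h
          exact_mod_cast h
      _ = 2 ^ N * ∑ j ∈ (range (N + 1)).filter (fun j => θ ≤ j), b N j := thresholdSharp_sum_choose_eq N _
      _ ≤ 2 ^ N * ∑ j ∈ (range (N + 1)).filter (fun j => N / 2 + t ≤ j), b N j :=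
          mul_le_mul_of_nonneg_left (sum_le_sum_of_subset_of_nonneg hsub fun j _ _ => b_nonneg _ _)
            (by positivity)
      _ ≤ 2 ^ N * ((N : ℝ) / (t : ℝ) ^ 2) :=
          mul_le_mul_of_nonneg_left (sum_b_le_of_half_add_le N ht0) (by positivity)
      _ ≤ 2 ^ N * ε :=
          mul_le_mul_of_nonneg_left (by rwa [div_le_iff₀ (pow_pos ht0' 2)]) (by positivity)

end Summit.PneNP.PneNP.Theorems.MonotoneSuffices.DensityShift
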